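import Literature.Geometry.Riemannian.HyperboloidModel
import Mathlib.Analysis.SpecialFunctions.Sqrt
import HarnessLib

/-!
# The conformal compactification of hyperbolic space onto the unit ball:
# `x = ξ/(1 + τ)`, `ρ = (1 - |x|²)/2`, and `|dx|² = ρ² g_ℍ`

Topic `Geometry/Riemannian`. The analytic heart of the statement "hyperbolic space `ℍⁿ` is a
conformally compact (indeed Poincaré–Einstein) filling of the round sphere `Sⁿ⁻¹`" — the model and
rigidity case of conformally compact Einstein manifolds (Li–Qing–Shi 2017, Def. 2.1 and Thm. 1.7:
"`(Xⁿ, g⁺)` is isometric to the hyperbolic space `(ℍⁿ, g_ℍ)` provided that the conformal infinity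
is the round conformal sphere"; Lee 2018, Ch. 3, Thm. 3.7 (c): the Poincaré ball model
`4|dx|²/(1-|x|²)²` and the "hyperbolic stereographic projection" `π(ξ, τ) = ξ/(1 + τ)` from the
hyperboloid `ℍⁿ(1) = {τ² - |ξ|² = 1, τ > 0}` onto the unit ball, an isometry between the two
models). In the graph chart `ξ ∈ V` of the hyperboloid (`HyperboloidModel.lean`:
`τ(u) = √(1 + ‖u‖²)`, metric components `G_u(v, w) = ⟪v, w⟫ - ⟪u, v⟫⟪u, w⟫/τ²`,
`Hyperboloid.comp`) we define and prove:

* `Hyperboloid.tauFn u = √(1 + ‖u‖²)` (`τ ≥ 1`, `τ² = 1 + ‖u‖²`, smooth, `dτ_u v = ⟪u, v⟫/τ`);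
* `Hyperboloid.ballMap u = (1 + τ(u))⁻¹ • u` — **the compactification map `x = ξ/(1 + τ)`** of the
  hyperboloid graph model into the open unit ball (Lee 2018, (3.13)/(3.14), `R = 1`):
  `‖ballMap u‖ < 1` (`norm_ballMap_lt_one`, indeed `‖x‖² = (τ-1)/(τ+1)`), injective
  (`ballMap_injective`, left inverse `x ↦ 2x/(1 - ‖x‖²)`), onto the open ball
  (`exists_ballMap_eq_of_norm_lt_one`), smooth (`contDiff_ballMap`), with differential
  `d(ballMap)_u v = (1+τ)⁻¹ v - (τ(1+τ)²)⁻¹ ⟪u, v⟫ u` (`hasFDerivAt_ballMap`);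
* `Hyperboloid.ballDefFn x = (1 - ‖x‖²)/2` — **the defining function `ρ` of the sphere in the
  closed ball** used to compactify (`ρ > 0` inside, `ρ = 0` on `‖x‖ = 1`, `dρ_x v = -⟪x, v⟫`, so
  `|dρ| = ‖x‖ = 1` on the boundary — the asymptotically hyperbolic normalisation
  `|dρ|²_{ρ²g⁺} = 1` of Li–Qing–Shi 2017, Def. 2.1); along the compactification map
  `ρ(ballMap u) = (1 + τ(u))⁻¹` (`ballDefFn_ballMap`);
* **`inner_ballMapDeriv_eq`** — the KEY identity
  `⟪d(ballMap)_u v, d(ballMap)_u w⟫ = ρ(ballMap u)² · G_u(v, w)`: the Euclidean metric pulled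
  back along `x = ξ/(1+τ)` is `ρ²` times the hyperbolic metric, i.e. `|dx|² = ρ² g_ℍ` with
  `ρ = (1 - |x|²)/2` — conjunct (9a) `j^*ḡ = (ρ ∘ j)² g⁺` of a conformally compact filling
  (`ConformallyCompactFilling.lean`) for `g⁺ = g_ℍ`, `ḡ = |dx|²` on the closed unit ball,
  equivalently Lee's `(π⁻¹)^* ğ = 4|dx|²/(1-|x|²)²` (Thm. 3.7 (c)).

Everything is proved; the three definitions are real (`def` with bodies); no named facts.

## References

* J. M. Lee, *Introduction to Riemannian Manifolds*, 2nd ed. (2018), Ch. 3, Thm. 3.7 and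
  (3.13)–(3.14) (hyperbolic stereographic projection, Poincaré ball). [Lee2018]
* G. Li, J. Qing, Y. Shi, Trans. Amer. Math. Soc. 369 (2017) 4385–4413 (arXiv:1410.6402),
  Def. 2.1 (p. 6), Thm. 1.7 (p. 4). [LiQingShi2017]
-/

noncomputable section

open scoped RealInnerProductSpace ContDiff Topology

namespace Literature.Geometry.Riemannian

namespace Hyperboloid

-- instance search through the nested operator type `V →L[ℝ] V →L[ℝ] ℝ` of the metric components
set_option maxSynthPendingDepth 3

section Norm

variable {V : Type*} [NormedAddCommGroup V]

/-! ### The height `τ = √(1 + ‖u‖²)` of the graph chart -/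

/-- The height function `τ(u) = √(1 + ‖u‖²)` of the upper sheet of the hyperboloid over the
graph chart `ξ = u` (Lee 2018, Thm. 3.7 (a): `τ² - |ξ|² = 1`, `τ > 0`). [cite: Lee2018, Thm. 3.7 (a)] -/
def tauFn (u : V) : ℝ := Real.sqrt (1 + ‖u‖ ^ 2)

/-- `τ(u) = √(1 + ‖u‖²)`. [folklore] -/
theorem tauFn_def (u : V) : tauFn u = Real.sqrt (1 + ‖u‖ ^ 2) := rfl

/-- `τ² = 1 + ‖u‖²`. [cite: Lee2018, Thm. 3.7 (a)] -/
theorem tauFn_sq (u : V) : tauFn u ^ 2 = 1 + ‖u‖ ^ 2 :=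
  Real.sq_sqrt (one_add_norm_sq_pos u).le

/-- `τ ≥ 1`. [folklore] -/
theorem one_le_tauFn (u : V) : 1 ≤ tauFn u :=
  Real.one_le_sqrt.2 (le_add_of_nonneg_right (sq_nonneg _))

/-- `τ > 0`. [folklore] -/
theorem tauFn_pos (u : V) : 0 < tauFn u := one_pos.trans_le (one_le_tauFn u)

/-- `1 + τ > 0`. [folklore] -/
theorem one_add_tauFn_pos (u : V) : 0 < 1 + tauFn u := by linarith [one_le_tauFn u]

/-- `w(u) = τ⁻²` (`Hyperboloid.weight`). [folklore] -/
theorem weight_eq_inv_tauFn_sq (u : V) : weight u = (tauFn u ^ 2)⁻¹ := by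
  rw [weight, tauFn_sq]

/-! ### The defining function `ρ = (1 - ‖x‖²)/2` -/

/-- **The defining function of the unit sphere in the closed unit ball** used to compactify
hyperbolic space, `ρ(x) = (1 - ‖x‖²)/2`: positive on the open ball, zero exactly on the unit
sphere, with `dρ_x = -⟪x, ·⟫`, so that `|dρ| = ‖x‖ = 1` on the sphere (the asymptotically
hyperbolic normalisation `|dρ|²_{ρ² g⁺}|_{ρ = 0} = 1`, Li–Qing–Shi 2017, Def. 2.1); the
compactified metric `ρ² g_ℍ` is the Euclidean metric (`inner_ballMapDeriv_eq`).
[cite: LiQingShi2017, Def. 2.1 (p. 6)] [cite: Lee2018, Thm. 3.7 (c)] -/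
def ballDefFn (x : V) : ℝ := (1 - ‖x‖ ^ 2) / 2

/-- `ρ(x) = (1 - ‖x‖²)/2`. [folklore] -/
theorem ballDefFn_def (x : V) : ballDefFn x = (1 - ‖x‖ ^ 2) / 2 := rfl

/-- `ρ > 0` on the open unit ball. [folklore] -/
theorem ballDefFn_pos {x : V} (hx : ‖x‖ < 1) : 0 < ballDefFn x := by
  rw [ballDefFn]
  have : ‖x‖ ^ 2 < 1 := by nlinarith [norm_nonneg x]
  linarith

/-- `ρ ≥ 0` on the closed unit ball. [folklore] -/
theorem ballDefFn_nonneg {x : V} (hx : ‖x‖ ≤ 1) : 0 ≤ ballDefFn x := by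
  rw [ballDefFn]
  have : ‖x‖ ^ 2 ≤ 1 := by nlinarith [norm_nonneg x]
  linarith

/-- `ρ x = 0 ↔ ‖x‖ = 1`. [folklore] -/
theorem ballDefFn_eq_zero_iff (x : V) : ballDefFn x = 0 ↔ ‖x‖ = 1 := by
  rw [ballDefFn, div_eq_zero_iff, or_iff_left (two_ne_zero), sub_eq_zero]
  constructor
  · intro h
    have h' : ‖x‖ ^ 2 = 1 ^ 2 := by rw [← h]; ring
    exact (sq_eq_sq₀ (norm_nonneg x) zero_le_one).1 h'
  · intro h
    rw [h]; ring

end Norm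

section Smul

variable {V : Type*} [NormedAddCommGroup V] [NormedSpace ℝ V]

/-! ### The compactification map `x = ξ/(1 + τ)` onto the unit ball -/

/-- **The compactification map of the hyperboloid graph model onto the unit ball**,
`ballMap u = (1 + τ(u))⁻¹ • u`, i.e. the hyperbolic stereographic projection `π(ξ, τ) = ξ/(1 + τ)`
of Lee 2018, (3.13) (`R = 1`) read in the graph chart `ξ = u`, `τ = √(1 + ‖u‖²)`; it carries the
hyperboloid model onto the Poincaré ball model (Thm. 3.7 (c)). [cite: Lee2018, Thm. 3.7 (c) and (3.13)] -/
def ballMap (u : V) : V := (1 + tauFn u)⁻¹ • u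

/-- `ballMap u = (1 + τ)⁻¹ • u`. [cite: Lee2018, (3.13)] -/
theorem ballMap_def (u : V) : ballMap u = (1 + tauFn u)⁻¹ • u := rfl

/-- `‖ballMap u‖ = ‖u‖/(1 + τ)`. [folklore] -/
theorem norm_ballMap (u : V) : ‖ballMap u‖ = ‖u‖ / (1 + tauFn u) := by
  rw [ballMap, norm_smul, Real.norm_eq_abs, abs_of_pos (inv_pos.2 (one_add_tauFn_pos u)),
    div_eq_inv_mul]

/-- `‖ballMap u‖² = (τ - 1)/(τ + 1)`. [cite: Lee2018, Thm. 3.7 (c)] -/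
theorem norm_ballMap_sq (u : V) : ‖ballMap u‖ ^ 2 = (tauFn u - 1) / (tauFn u + 1) := by
  have hτ : 1 + tauFn u ≠ 0 := (one_add_tauFn_pos u).ne'
  have hτ' : tauFn u + 1 ≠ 0 := by rw [add_comm]; exact hτ
  have hsq : ‖u‖ ^ 2 = tauFn u ^ 2 - 1 := by rw [tauFn_sq]; ring
  rw [norm_ballMap, div_pow, hsq, div_eq_div_iff (pow_ne_zero 2 hτ) hτ']
  ring

/-- **The compactification map lands in the open unit ball**: `‖ballMap u‖ < 1`.
[cite: Lee2018, Thm. 3.7 (c)] -/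
theorem norm_ballMap_lt_one (u : V) : ‖ballMap u‖ < 1 := by
  have hτ := one_add_tauFn_pos u
  have h1 : ‖ballMap u‖ ^ 2 < 1 := by
    rw [norm_ballMap_sq, div_lt_one (by linarith [one_le_tauFn u])]
    linarith
  nlinarith [norm_nonneg (ballMap u)]

/-- `1 - ‖ballMap u‖² = 2/(1 + τ)`. [folklore] -/
theorem one_sub_norm_ballMap_sq (u : V) : 1 - ‖ballMap u‖ ^ 2 = 2 / (1 + tauFn u) := by
  have hτ : 1 + tauFn u ≠ 0 := (one_add_tauFn_pos u).ne'
  have hτ' : tauFn u + 1 ≠ 0 := by rw [add_comm]; exact hτ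
  rw [norm_ballMap_sq, eq_div_iff hτ, sub_mul, div_mul_eq_mul_div, add_comm 1 (tauFn u),
    mul_div_assoc, div_self hτ', mul_one]
  ring

/-- **Along the compactification map, `ρ(ballMap u) = (1 + τ(u))⁻¹`.** [cite: Lee2018, Thm. 3.7 (c)] -/
theorem ballDefFn_ballMap (u : V) : ballDefFn (ballMap u) = (1 + tauFn u)⁻¹ := by
  rw [ballDefFn, one_sub_norm_ballMap_sq, div_div, mul_comm, ← div_div, div_self two_ne_zero,
    one_div]

/-- `ρ(ballMap u) > 0`. [folklore] -/
theorem ballDefFn_ballMap_pos (u : V) : 0 < ballDefFn (ballMap u) := by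
  rw [ballDefFn_ballMap]
  exact inv_pos.2 (one_add_tauFn_pos u)

/-! ### Injectivity and image of the compactification map -/

/-- **Left inverse `x ↦ 2x/(1 - ‖x‖²)`** of the compactification map (Lee 2018, (3.14):
`π⁻¹(x) = (2x/(1-|x|²), (1+|x|²)/(1-|x|²))`, first component). [cite: Lee2018, (3.14)] -/
theorem two_div_one_sub_norm_sq_smul_ballMap (u : V) :
    (2 / (1 - ‖ballMap u‖ ^ 2)) • ballMap u = u := by
  rw [one_sub_norm_ballMap_sq, ballMap, smul_smul]
  have hτ : 1 + tauFn u ≠ 0 := (one_add_tauFn_pos u).ne'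
  have : 2 / (2 / (1 + tauFn u)) * (1 + tauFn u)⁻¹ = 1 := by field_simp
  rw [this, one_smul]

/-- The compactification map is injective. [cite: Lee2018, Thm. 3.7 (c)] -/
theorem ballMap_injective : Function.Injective (ballMap : V → V) := by
  intro u u' h
  rw [← two_div_one_sub_norm_sq_smul_ballMap u, ← two_div_one_sub_norm_sq_smul_ballMap u', h]

/-- **The compactification map is onto the open unit ball**: every `x` with `‖x‖ < 1` is
`ballMap (2x/(1 - ‖x‖²))`. [cite: Lee2018, (3.14)] -/
theorem ballMap_two_div_smul {x : V} (hx : ‖x‖ < 1) :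
    ballMap ((2 / (1 - ‖x‖ ^ 2)) • x) = x := by
  have hx2 : ‖x‖ ^ 2 < 1 := by nlinarith [norm_nonneg x]
  have hd : 0 < 1 - ‖x‖ ^ 2 := by linarith
  -- `τ(2x/(1-|x|²)) = (1+|x|²)/(1-|x|²)`
  have hτ : tauFn ((2 / (1 - ‖x‖ ^ 2)) • x) = (1 + ‖x‖ ^ 2) / (1 - ‖x‖ ^ 2) := by
    rw [tauFn, norm_smul, Real.norm_eq_abs, abs_of_pos (div_pos two_pos hd), mul_pow,
      show 1 + (2 / (1 - ‖x‖ ^ 2)) ^ 2 * ‖x‖ ^ 2 = ((1 + ‖x‖ ^ 2) / (1 - ‖x‖ ^ 2)) ^ 2 by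
        field_simp; ring]
    exact Real.sqrt_sq (div_nonneg (by positivity) hd.le)
  rw [ballMap, hτ, smul_smul]
  have hd' : 1 - ‖x‖ ^ 2 ≠ 0 := hd.ne'
  have : (1 + (1 + ‖x‖ ^ 2) / (1 - ‖x‖ ^ 2))⁻¹ * (2 / (1 - ‖x‖ ^ 2)) = 1 := by
    rw [one_add_div hd', inv_div, div_mul_div_comm, div_eq_one_iff_eq (mul_ne_zero (by nlinarith) hd')]
    ring
  rw [this, one_smul]

/-- The image of the compactification map is exactly the open unit ball. [cite: Lee2018, Thm. 3.7 (c)] -/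
theorem range_ballMap : Set.range (ballMap : V → V) = Metric.ball 0 1 := by
  ext x
  simp only [Set.mem_range, Metric.mem_ball, dist_zero_right]
  constructor
  · rintro ⟨u, rfl⟩
    exact norm_ballMap_lt_one u
  · intro hx
    exact ⟨_, ballMap_two_div_smul hx⟩

end Smul

/-! ### Calculus on an inner product space -/

section Inner

variable {V : Type*} [NormedAddCommGroup V] [InnerProductSpace ℝ V]

/-- `τ` is smooth (square root of a positive smooth function). [folklore] -/
theorem contDiff_tauFn : ContDiff ℝ ∞ (tauFn : V → ℝ) := by
  refine ContDiff.sqrt ?_ fun u ↦ (one_add_norm_sq_pos u).ne'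
  exact contDiff_const.add (contDiff_norm_sq ℝ)

/-- `dτ_u v = ⟪u, v⟫/τ`: the differential of `τ` is `τ⁻¹ ⟪u, ·⟫`. [cite: Lee2018, Thm. 3.7 (a)] -/
theorem hasFDerivAt_tauFn (u : V) : HasFDerivAt (tauFn : V → ℝ) ((tauFn u)⁻¹ • dot u) u := by
  have h1 : HasFDerivAt (fun y : V ↦ 1 + ‖y‖ ^ 2) ((2 : ℝ) • dot u) u := by
    have h := (hasStrictFDerivAt_norm_sq u).hasFDerivAt.const_add 1
    have e : (2 • (innerSL ℝ u : V →L[ℝ] ℝ)) = (2 : ℝ) • dot u := by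
      rw [two_nsmul, two_smul]; rfl
    rw [e] at h
    exact h
  have h2 := h1.sqrt (one_add_norm_sq_pos u).ne'
  have h0 : Real.sqrt (1 + ‖u‖ ^ 2) ≠ 0 := (Real.sqrt_pos.2 (one_add_norm_sq_pos u)).ne'
  have h3 : (1 / (2 * Real.sqrt (1 + ‖u‖ ^ 2))) • ((2 : ℝ) • dot u) = (tauFn u)⁻¹ • dot u := by
    rw [smul_smul, tauFn]
    congr 1
    field_simp
  rw [← h3]
  exact h2

/-- `ρ` is smooth. [folklore] -/
theorem contDiff_ballDefFn : ContDiff ℝ ∞ (ballDefFn : V → ℝ) :=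
  (contDiff_const.sub (contDiff_norm_sq ℝ)).div_const 2

/-- `dρ_x = -⟪x, ·⟫`. [folklore] -/
theorem hasFDerivAt_ballDefFn (x : V) : HasFDerivAt (ballDefFn : V → ℝ) (-dot x) x := by
  have h1 : HasFDerivAt (fun y : V ↦ 1 - ‖y‖ ^ 2) (-((2 : ℝ) • dot x)) x := by
    have h := (hasStrictFDerivAt_norm_sq x).hasFDerivAt.const_sub 1
    have e : (2 • (innerSL ℝ x : V →L[ℝ] ℝ)) = (2 : ℝ) • dot x := by
      rw [two_nsmul, two_smul]; rfl
    rw [e] at h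
    exact h
  have h2 := h1.const_mul (1 / 2 : ℝ)
  have hfun : (fun y : V ↦ (1 / 2 : ℝ) * (1 - ‖y‖ ^ 2)) = ballDefFn := by
    funext y
    rw [ballDefFn]
    ring
  have h3 : (1 / 2 : ℝ) • (-((2 : ℝ) • dot x)) = -dot x := by
    rw [smul_neg, smul_smul, show (1 / 2 : ℝ) * 2 = 1 by norm_num, one_smul]
  rw [hfun, h3] at h2
  exact h2

/-! ### Smoothness and differential -/

/-- The compactification map is smooth. [folklore] -/
theorem contDiff_ballMap : ContDiff ℝ ∞ (ballMap : V → V) := by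
  refine ContDiff.smul ?_ contDiff_id
  exact (contDiff_const.add contDiff_tauFn).inv fun u ↦ (one_add_tauFn_pos u).ne'

/-- **The differential of the compactification map** (product rule for `(1+τ)⁻¹ • id`):
`d(ballMap)_u = (1+τ)⁻¹ id - (1+τ)⁻² τ⁻¹ ⟪u, ·⟫ u`. [cite: Lee2018, Thm. 3.7 (c)] -/
theorem hasFDerivAt_ballMap (u : V) :
    HasFDerivAt (ballMap : V → V)
      ((1 + tauFn u)⁻¹ • ContinuousLinearMap.id ℝ V +
        ((-((1 + tauFn u) ^ 2)⁻¹) • ((tauFn u)⁻¹ • dot u)).smulRight u) u := by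
  have hτ1 := one_add_tauFn_pos u
  -- the scalar factor `f = (1 + τ)⁻¹` and its differential `-(1+τ)⁻² τ⁻¹ ⟪u, ·⟫`
  have hf : HasFDerivAt (fun y : V ↦ (1 + tauFn y)⁻¹)
      ((-((1 + tauFn u) ^ 2)⁻¹) • ((tauFn u)⁻¹ • dot u)) u := by
    have h1 : HasFDerivAt (fun y : V ↦ 1 + tauFn y) ((tauFn u)⁻¹ • dot u) u :=
      (hasFDerivAt_tauFn u).const_add 1
    exact (hasDerivAt_inv hτ1.ne').comp_hasFDerivAt u h1
  exact hf.smul (hasFDerivAt_id (𝕜 := ℝ) u)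

/-- **The differential, evaluated**: `d(ballMap)_u v = (1+τ)⁻¹ v - (τ(1+τ)²)⁻¹ ⟪u, v⟫ u`.
[cite: Lee2018, Thm. 3.7 (c)] -/
theorem fderiv_ballMap_apply (u v : V) :
    fderiv ℝ ballMap u v = (1 + tauFn u)⁻¹ • v - ((tauFn u * (1 + tauFn u) ^ 2)⁻¹ * ⟪u, v⟫) • u := by
  rw [(hasFDerivAt_ballMap u).fderiv]
  simp only [FunLike.coe_add, Pi.add_apply, FunLike.coe_smul, Pi.smul_apply,
    ContinuousLinearMap.smulRight_apply, ContinuousLinearMap.id_apply, dot_apply, smul_eq_mul]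
  have hs : -((1 + tauFn u) ^ 2)⁻¹ * ((tauFn u)⁻¹ * ⟪u, v⟫) =
      -((tauFn u * (1 + tauFn u) ^ 2)⁻¹ * ⟪u, v⟫) := by
    rw [mul_inv]
    ring
  rw [hs, neg_smul, ← sub_eq_add_neg]

/-! ### The key identity: the Euclidean metric pulled back along `x = ξ/(1+τ)` is `ρ² g_ℍ` -/

/-- **`⟪d(ballMap)_u v, d(ballMap)_u w⟫ = ρ(ballMap u)² · G_u(v, w)`**: the Euclidean metric of the
unit ball pulled back along the compactification map is `ρ²` times the hyperbolic metric
`G = Hyperboloid.comp` of the graph chart, `ρ = (1 - |x|²)/2` — equivalently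
`g_ℍ = 4|dx|²/(1 - |x|²)²`, the Poincaré ball model (Lee 2018, Thm. 3.7 (c):
`(π⁻¹)^* ğ = 4R⁴|dx|²/(R² - |x|²)²`, `R = 1`), and the conformal relation `j^*ḡ = (ρ ∘ j)² g⁺`
(conjunct (9a) of `IsConformallyCompactFillingOfDim`) for `g⁺ = g_ℍ`, `ḡ = |dx|²`, `j = ballMap`.
Proof: expand with `d(ballMap)_u v = (1+τ)⁻¹ v - (τ(1+τ)²)⁻¹ ⟪u,v⟫ u`, `‖u‖² = τ² - 1`,
`ρ(ballMap u) = (1+τ)⁻¹`, `G_u(v,w) = ⟪v,w⟫ - ⟪u,v⟫⟪u,w⟫/τ²`. [cite: Lee2018, Thm. 3.7 (c)]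
[cite: LiQingShi2017, Def. 2.1 (p. 6)] -/
theorem inner_ballMapDeriv_eq (u v w : V) :
    ⟪fderiv ℝ ballMap u v, fderiv ℝ ballMap u w⟫ = ballDefFn (ballMap u) ^ 2 * comp u v w := by
  have hτ := tauFn_pos u
  have hτ1 := one_add_tauFn_pos u
  have hsq : ‖u‖ ^ 2 = tauFn u ^ 2 - 1 := by rw [tauFn_sq]; ring
  rw [fderiv_ballMap_apply, fderiv_ballMap_apply, ballDefFn_ballMap, comp_apply,
    weight_eq_inv_tauFn_sq]
  simp only [inner_sub_left, inner_sub_right, inner_smul_left, inner_smul_right,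
    RCLike.conj_to_real, real_inner_self_eq_norm_sq, hsq, real_inner_comm v u,
    real_inner_comm w u, real_inner_comm w v]
  field_simp
  ring

/-- The same with `ρ²` written out: `⟪dJ v, dJ w⟫ = (1+τ)⁻² G_u(v, w)`. [cite: Lee2018, Thm. 3.7 (c)] -/
theorem inner_ballMapDeriv_eq' (u v w : V) :
    ⟪fderiv ℝ ballMap u v, fderiv ℝ ballMap u w⟫ = ((1 + tauFn u) ^ 2)⁻¹ * comp u v w := by
  rw [inner_ballMapDeriv_eq, ballDefFn_ballMap, inv_pow]

/-- **The differential of the compactification map is injective** (its Gram form is `ρ² G_u` with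
`ρ > 0` and `G_u` positive definite). [folklore] -/
theorem fderiv_ballMap_injective (u : V) : Function.Injective (fderiv ℝ ballMap u) := by
  intro v w hvw
  have h0 : fderiv ℝ ballMap u (v - w) = 0 := by rw [map_sub, hvw, sub_self]
  have h1 := inner_ballMapDeriv_eq u (v - w) (v - w)
  rw [h0, inner_zero_left] at h1
  have hρ : 0 < ballDefFn (ballMap u) ^ 2 := pow_pos (ballDefFn_ballMap_pos u) 2
  have hG : comp u (v - w) (v - w) = 0 := by
    have := mul_eq_zero.1 h1.symm
    exact this.resolve_left hρ.ne'
  by_contra hne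
  have hpos := comp_pos u (sub_ne_zero.2 hne)
  rw [hG] at hpos
  exact lt_irrefl _ hpos

end Inner

end Hyperboloid

end Literature.Geometry.Riemannian
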